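import Literature.MathematicalPhysics.QuantumFieldTheory.Balaban1983to89.B13Integral223
import Literature.Analysis.SpecialFunctions.RealGaussianComplexQuadratic

/-!
# `Balaban1983to89.B13FirstEstimate215` — T. Bałaban, *Renormalization group approach to lattice gauge field
theories. II. Cluster expansions*, Commun. Math. Phys. **116** (1988) 1–22 [Balaban1988RG2Cluster], p. 15: the
MODULUS STEP of the «first estimate» (2.15) at COMPLEX parameters — the complex Gaussian normalisation of the measure
`dμ_{C^{(k)}(Z₀,σ(Z))}` of (2.14), the determinant factor `|det C^{(k)}(Z₀,σ(Z))⁻¹ / det Re C^{(k)}(Z₀,σ(Z))⁻¹|^{1/2}`,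
and lines 2–4 of (2.15) for the objects of record of (2.14) (`B13Term214`), PROVED in the finite-dimensional model

statement-level skeleton of published theorems with citation tags; proofs where landed; nothing here is a claim about
the Yang–Mills mass gap

PDF held: `paper:balaban1988-cmp116-rg-ii-cluster` (journal page = PDF page + 0); quotations read as images from
`run/shared/lean/pub/pub-balaban/b2b-balaban-ref1/pages/1988-cmp116-rg-II-cluster/1988-cmp116-rg-II-cluster-p015-x2.png`.

CITATION HEADER (verbatim, p. 15 [PDF 15]).  After (2.14) (`Γ_k(Z₀, σ(Z)) = C*Δ_k(σ(Z))CZ₀ᶜ(C^{(k)})^{1/2}(σ(Z))`):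
*"We consider it as an analytic function of (𝐔, 𝐉) in the space 𝐔ᶜ_{k+1}(X, α₀, α₁), and of the complex parameters
σ(Z), τ. This complicates estimates of this expression, because the operators in it are not symmetric, and the second
measure is complex. … For the pair (U, 0) the operators are symmetric, and the measure is positive, and then the
estimates are simpler. The general case is handled by a perturbative argument. The first estimate is
  `|(7.14)| ≦ exp(−(κ₁ − 1)(LM)⁻⁴|Z∖Z′₀|) Π_{Y∈𝐃} 2/|τ(Y)|
     · ∫dμ₀(X)|_Z exp(−½ Re⟨Γ_k(Z₀,σ(Z))X, C^{(k)}(Z₀,σ(Z))Γ_k(Z₀,σ(Z))X⟩)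
     · |det(C^{(k)}(Z₀,σ(Z))⁻¹) / det(Re C^{(k)}(Z₀,σ(Z))⁻¹)|^{1/2} ∫dμ_{(Re C^{(k)}(Z₀σ(Z))⁻¹)⁻¹}(B)
     · exp(−⟨B, Re Γ_k(Z₀,σ(Z))X⟩) χ_{k,Y₀} χᶜ_{k,P} exp[Σ_{Y∈𝐃} |τ(Y)||𝐕_k(Y,B)|].`                      (2.15)
In the expression on the right-hand side we replace the operators by the corresponding operators with σ(Z) = 0,
𝐔 = U, 𝐉 = 0, and we estimate the error."*  [label slip «(7.14)» = (2.14), recorded in `B13Term214` / the cell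
transcript.]

WHAT IS REPRODUCED (unit `lit-balaban-r10` gen 8, B13 fold owner; SKELETON rows `B13.Eq2.15` — «proved-existing (pieces)
· absent (assembly, schematic) · Cauchy part assembled (r10 g7)» — and `B13.Eq2.14` of `HOME/lit-balaban-r10/ROWS-B13.md`,
HOME = `run/shared/lean/pub/lit-balaban/`).  The Cauchy factors `exp(−(κ₁−1)(LM)⁻⁴|Z∖Z′₀|)·Π 2/|τ(Y)|` of line 1 are
`B13CauchyDecay.norm_term214_le_215` (gen 7): they bound the term (2.14) by the SUP over the parameter polydiscs of the
modulus of its `X`-integral (lines 2–4 of (2.14), `B13Term214.core214` = `cgaussMean 1 (integrand214 A Γ F)`).  THIS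
FILE proves the printed bound for that modulus at ONE (complex) parameter value — lines 2–4 of (2.15) — in the model of
record of (2.14) (`B13Term214` Part B: real fields `B : Λ → ℝ`, `X : Λ ⊕ C₀ → ℝ`; COMPLEX precision `A =
C^{(k)}(Z₀,σ(Z))⁻¹ : Matrix Λ Λ ℂ`, symmetric — covariances are symmetric operators continued analytically in σ — with
positive definite real part `Re A = Re C^{(k)}(Z₀,σ(Z))⁻¹` (the perturbative regime of p. 16); complex `Γ = Γ_k(Z₀,σ(Z))`;
complex last line `F`):
* §1 **the complex Gaussian normalisation** (*"the second measure is complex"*): `cgaussNorm_sq_mul_det` —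
  `(∫dB e^{−½⟨B,AB⟩})² · det A = (2π)^{|Λ|}` for complex symmetric `A` with `Re A ≻ 0`, the branch-free form of
  `∫ = (2π)^{n/2}(det A)^{−1/2}`, from the tree's `Literature.Analysis.SpecialFunctions.RealGaussianComplexQuadratic`
  (`sq_integral_cexp_quadratic_mul_det`, Hörmander *ALPDO I* Thm 7.6.1) applied to the weight `B13Term214.cgaussWeight`;
  hence `cgaussNorm A ≠ 0`, `det A ≠ 0`, `‖cgaussNorm A‖²·‖det A‖ = (2π)^{|Λ|}`, and **`gaussNorm_div_norm_cgaussNorm`**: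
  `∫dB e^{−½⟨B,(Re A)B⟩} / ‖∫dB e^{−½⟨B,AB⟩}‖ = |det A / det Re A|^{1/2}` — THE DETERMINANT FACTOR OF (2.15).
* §2 **the modulus of the complex Gaussian mean**: `norm_cgaussMean_le_215` — `‖∫dμ_{A⁻¹}(B)Ψ(B)‖ ≤ |det A/det Re A|^{1/2}
  · ∫dμ_{(Re A)⁻¹}(B) g(B)` for any majorant `g ≥ ‖Ψ‖` integrable against the weight of `Re A` (`|e^{−½⟨B,AB⟩}| =
  e^{−½⟨B,(Re A)B⟩}`, `B13Term214.norm_cgaussWeight`; `|∫| ≤ ∫|·|`; nothing is asked of `Ψ`).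
* §3 **lines 2–4 of (2.15) for the objects of record**: `norm_cexp_neg_dotProduct` (`|e^{−⟨B,ΓX⟩}| = e^{−⟨B, Re ΓX⟩}`),
  `norm_F214_le_printed` (`|(−1)^{|P|}χχᶜe^{Στ𝐕}| ≤ χχᶜ e^{Σ|τ||𝐕|}`, the printed last line), **`norm_integrand214_le_215`**
  (lines 2–3: `‖integrand214 A Γ F X‖ ≤ exp(−½Re⟨ΓX, A⁻¹ΓX⟩)·|det A/det Re A|^{1/2}·∫dμ_{(Re A)⁻¹}(B) e^{−⟨B,Re ΓX⟩}g(B)`),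
  **`norm_core214_le_215`** (with the `X`-integral: `‖∫dμ₀(X) integrand214‖ ≤ ∫dμ₀(X)[that bound]`, the modulus of the
  REAL Gaussian mean `dμ₀` being `B13Integral223.norm_gaussMean_le`), and `norm_core214_F214_le_215` — the same with the
  printed last line inserted.
HONEST SCOPE.  This is (2.15) minus its Cauchy prefactors (gen 7) and BEFORE the perturbative replacement σ(Z) → 0,
(𝐔,𝐉) → (U,0): the bounds (2.16)–(2.17) on `R₁, R₂, R₃` and the determinant quotients that turn the right side of (2.15)
into (2.23) stay BY ASSERTION (cell locus L16a; structural consequences `B13PerturbativeStep` §§3–5); at σ = 0 the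
continuation is `B13Integral223` §7–§8 and (2.23)–(2.26).  Integrability of the majorants is carried as hypotheses
(`hg`, `hX`), exactly what `|∫| ≤ ∫|·|` needs; the positivity `Re C^{(k)}(Z₀,σ(Z))⁻¹ ≻ 0` is the hypothesis `hA`
(print: perturbative, from (2.16)).  Every declaration is a proved `theorem`; no `sorry`, no definition, no new named
fact (D-0026); display-specific statements carry the locator, plumbing is tagged "(elementary API for (2.15))".
-/

noncomputable section

namespace Literature.MathematicalPhysics.QuantumFieldTheory.Balaban1983to89.B13FirstEstimate215

open Matrix MeasureTheory Finset Complex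
open scoped Real
open Literature.Analysis.SpecialFunctions (sq_integral_cexp_quadratic_mul_det dotProduct_mulVec_ofReal_eq)
open B13GaugeDevices (gaussWeight gaussInt gaussNorm gaussMean)
open B2Eq228Conditioning (gaussNorm_eq gaussNorm_pos gaussNorm_nonneg)
open B13Term214 (cquad cgaussWeight cgaussInt cgaussNorm cgaussMean integrand214 F214)
open B13Integral223 (norm_gaussMean_le)

variable {Λ : Type} [Fintype Λ] [DecidableEq Λ]

/-! ## §1. The complex Gaussian normalisation (the measure `dμ_{C^{(k)}(Z₀,σ(Z))}` of (2.14)) -/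

omit [DecidableEq Λ] in
/-- The complex quadratic form of (2.14) (`B13Term214.cquad A v = Σᵢⱼ vᵢ Aᵢⱼ vⱼ`) is the complex pairing `⟨v, Av⟩` of
the real field `v` coerced to `ℂ`. [cite: Balaban1988RG2Cluster, (2.14)–(2.15) p.15] (elementary API for (2.15)) -/
theorem cquad_eq_dotProduct (A : Matrix Λ Λ ℂ) (v : Λ → ℝ) :
    cquad A v = (fun i => (v i : ℂ)) ⬝ᵥ (A *ᵥ fun i => (v i : ℂ)) := by
  simp only [cquad, dotProduct, mulVec, Finset.mul_sum]
  exact Finset.sum_congr rfl fun i _ => Finset.sum_congr rfl fun j _ => by ring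

omit [DecidableEq Λ] in
/-- The exponent of the complex weight split into real and imaginary parts: `−½⟨B, AB⟩ = −½⟨B, (Re A)B⟩ +
i·⟨B, (−½ Im A)B⟩` (*"the operators in it are not symmetric, and the second measure is complex"*).
[cite: Balaban1988RG2Cluster, (2.14)–(2.15) p.15] (elementary API for (2.15)) -/
theorem neg_half_cquad_eq (A : Matrix Λ Λ ℂ) (x : Λ → ℝ) :
    -(1 / 2 : ℂ) * cquad A x
      = -(1 / 2 : ℂ) * ((x ⬝ᵥ (A.map Complex.re *ᵥ x) : ℝ) : ℂ)
        + I * ((x ⬝ᵥ (((-(1 / 2 : ℝ)) • A.map Complex.im) *ᵥ x) : ℝ) : ℂ) := by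
  rw [cquad_eq_dotProduct, dotProduct_mulVec_ofReal_eq, smul_mulVec, dotProduct_smul, smul_eq_mul]
  push_cast
  ring

omit [Fintype Λ] [DecidableEq Λ] in
/-- `Re A − 2i·(−½ Im A) = A` entrywise (the matrix of the branch-free formula is `A` itself).
[cite: Balaban1988RG2Cluster, (2.14)–(2.15) p.15] (elementary API for (2.15)) -/
theorem map_re_sub_smul_map_im (A : Matrix Λ Λ ℂ) :
    (A.map Complex.re).map Complex.ofReal
        - ((2 : ℂ) * I) • ((-(1 / 2 : ℝ)) • A.map Complex.im).map Complex.ofReal = A := by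
  ext i j
  simp only [Matrix.sub_apply, Matrix.smul_apply, Matrix.map_apply, smul_eq_mul, Complex.ofReal_mul,
    Complex.ofReal_neg, Complex.ofReal_div, Complex.ofReal_one, Complex.ofReal_ofNat]
  apply Complex.ext <;> simp

/-- **The complex Gaussian normalisation, branch-free** (*"the second measure is complex"*): for a complex SYMMETRIC
precision `A` (`A = C^{(k)}(Z₀,σ(Z))⁻¹`) with positive definite real part,
`(∫dB e^{−½⟨B,AB⟩})² · det A = (2π)^{|Λ|}` — the classical `∫dB e^{−½⟨B,AB⟩} = (2π)^{n/2}(det A)^{−1/2}` with the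
branch removed by squaring; from the tree's `RealGaussianComplexQuadratic.sq_integral_cexp_quadratic_mul_det`
(Hörmander *ALPDO I* Thm 7.6.1) applied to `B13Term214.cgaussNorm`. [cite: Balaban1988RG2Cluster, (2.14)–(2.15) p.15] -/
theorem cgaussNorm_sq_mul_det {A : Matrix Λ Λ ℂ} (hAs : A.IsSymm) (hA : (A.map Complex.re).PosDef) :
    cgaussNorm A ^ 2 * A.det = (2 * (π : ℂ)) ^ Fintype.card Λ := by
  have hQ : ((-(1 / 2 : ℝ)) • A.map Complex.im).IsSymm := by
    show ((-(1 / 2 : ℝ)) • A.map Complex.im)ᵀ = (-(1 / 2 : ℝ)) • A.map Complex.im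
    rw [transpose_smul, ← Matrix.transpose_map, hAs.eq]
  have h := sq_integral_cexp_quadratic_mul_det hA hQ
  rw [map_re_sub_smul_map_im] at h
  rw [← h, cgaussNorm]
  congr 2
  refine integral_congr_ae (Filter.Eventually.of_forall fun x => ?_)
  show cgaussWeight A x = _
  rw [cgaussWeight, neg_half_cquad_eq]

/-- Zero-freeness: the complex normalisation `∫dB e^{−½⟨B,AB⟩}` and `det A` do not vanish while `Re A ≻ 0` (so the
complex mean `B13Term214.cgaussMean A` = `dμ_{C^{(k)}(Z₀,σ(Z))}` is a genuine normalised functional).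
[cite: Balaban1988RG2Cluster, (2.14)–(2.15) p.15] -/
theorem cgaussNorm_ne_zero {A : Matrix Λ Λ ℂ} (hAs : A.IsSymm) (hA : (A.map Complex.re).PosDef) :
    cgaussNorm A ≠ 0 ∧ A.det ≠ 0 := by
  have h := cgaussNorm_sq_mul_det hAs hA
  have hne : (2 * (π : ℂ)) ^ Fintype.card Λ ≠ 0 :=
    pow_ne_zero _ (mul_ne_zero two_ne_zero (Complex.ofReal_ne_zero.mpr Real.pi_pos.ne'))
  rw [← h] at hne
  exact ⟨fun h0 => hne (by rw [h0]; ring), fun h0 => hne (by rw [h0, mul_zero])⟩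

/-- `‖∫dB e^{−½⟨B,AB⟩}‖² · |det A| = (2π)^{|Λ|}`, i.e. `‖∫dB e^{−½⟨B,AB⟩}‖ = (2π)^{n/2}|det A|^{−1/2}`.
[cite: Balaban1988RG2Cluster, (2.14)–(2.15) p.15] -/
theorem norm_cgaussNorm_sq_mul {A : Matrix Λ Λ ℂ} (hAs : A.IsSymm) (hA : (A.map Complex.re).PosDef) :
    ‖cgaussNorm A‖ ^ 2 * ‖A.det‖ = (2 * π) ^ Fintype.card Λ := by
  have h0 := cgaussNorm_sq_mul_det hAs hA
  have h : ‖cgaussNorm A ^ 2 * A.det‖ = ‖(2 * (π : ℂ)) ^ Fintype.card Λ‖ := by rw [h0]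
  rw [norm_mul, norm_pow, norm_pow] at h
  rw [h]
  congr 1
  have : (2 * (π : ℂ)) = ((2 * π : ℝ) : ℂ) := by push_cast; ring
  rw [this, Complex.norm_real, Real.norm_of_nonneg (by positivity)]

/-- The real case: `(∫dB e^{−½⟨B,MB⟩})² · det M = (2π)^{|Λ|}` for `M ≻ 0` (`B2Eq228Conditioning.gaussNorm_eq` squared).
[cite: Balaban1988RG2Cluster, (2.15) p.15] (elementary API for (2.15)) -/
theorem gaussNorm_sq_mul_det {M : Matrix Λ Λ ℝ} (hM : M.PosDef) :
    gaussNorm M ^ 2 * M.det = (2 * π) ^ Fintype.card Λ := by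
  rw [gaussNorm_eq hM, div_pow, ← pow_mul, mul_comm (Fintype.card Λ) 2, pow_mul,
    Real.sq_sqrt (by positivity : (0 : ℝ) ≤ 2 * π), Real.sq_sqrt hM.det_pos.le,
    div_mul_cancel₀ _ hM.det_pos.ne']

/-- **The determinant factor of (2.15)**: `∫dB e^{−½⟨B,(Re A)B⟩} / ‖∫dB e^{−½⟨B,AB⟩}‖ = |det A / det(Re A)|^{1/2}` —
the printed `|det(C^{(k)}(Z₀,σ(Z))⁻¹) / det(Re C^{(k)}(Z₀,σ(Z))⁻¹)|^{1/2}` with `A = C^{(k)}(Z₀,σ(Z))⁻¹`: the price of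
replacing the complex normalisation by the normalisation of the positive measure `dμ_{(Re C^{(k)}(Z₀,σ(Z))⁻¹)⁻¹}`.
[cite: Balaban1988RG2Cluster, (2.15) p.15] -/
theorem gaussNorm_div_norm_cgaussNorm {A : Matrix Λ Λ ℂ} (hAs : A.IsSymm) (hA : (A.map Complex.re).PosDef) :
    gaussNorm (A.map Complex.re) / ‖cgaussNorm A‖ = Real.sqrt (‖A.det‖ / (A.map Complex.re).det) := by
  have hN : 0 < ‖cgaussNorm A‖ := norm_pos_iff.2 (cgaussNorm_ne_zero hAs hA).1
  have hG : 0 < gaussNorm (A.map Complex.re) := gaussNorm_pos hA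
  have hd : 0 < (A.map Complex.re).det := hA.det_pos
  have hdA : 0 < ‖A.det‖ := norm_pos_iff.2 (cgaussNorm_ne_zero hAs hA).2
  have hsqG := gaussNorm_sq_mul_det hA
  have hsqN := norm_cgaussNorm_sq_mul hAs hA
  symm
  rw [Real.sqrt_eq_iff_mul_self_eq_of_pos (div_pos hG hN)]
  rw [div_mul_div_comm, div_eq_div_iff (mul_pos hN hN).ne' hd.ne']
  calc gaussNorm (A.map Complex.re) * gaussNorm (A.map Complex.re) * (A.map Complex.re).det
      = gaussNorm (A.map Complex.re) ^ 2 * (A.map Complex.re).det := by ring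
    _ = ‖cgaussNorm A‖ ^ 2 * ‖A.det‖ := by rw [hsqG, hsqN]
    _ = ‖A.det‖ * (‖cgaussNorm A‖ * ‖cgaussNorm A‖) := by ring

/-! ## §2. The modulus of the complex Gaussian mean -/

omit [DecidableEq Λ] in
/-- `|e^{−½⟨B,AB⟩}| = e^{−½⟨B,(Re A)B⟩}`: the modulus of the complex weight is the weight of `dμ_{(Re A)⁻¹}`
(`B13Term214.norm_cgaussWeight` in the `B13GaugeDevices.gaussWeight` spelling). [cite: Balaban1988RG2Cluster, (2.15) p.15] -/
theorem norm_cgaussWeight_eq_gaussWeight (A : Matrix Λ Λ ℂ) (v : Λ → ℝ) :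
    ‖cgaussWeight A v‖ = gaussWeight (A.map Complex.re) v := by
  rw [B13Term214.norm_cgaussWeight, gaussWeight]
  have : ∑ i, ∑ j, v i * (A i j).re * v j = v ⬝ᵥ (A.map Complex.re *ᵥ v) := by
    simp only [dotProduct, mulVec, Matrix.map_apply, Finset.mul_sum]
    exact Finset.sum_congr rfl fun i _ => Finset.sum_congr rfl fun j _ => by ring
  rw [this]
  ring_nf

/-- **(2.15), the measure line**: for a complex symmetric precision `A` with `Re A ≻ 0` and any complex integrand `Ψ`
with a majorant `g ≥ ‖Ψ‖` integrable against `e^{−½⟨B,(Re A)B⟩}`,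
`‖∫dμ_{A⁻¹}(B) Ψ(B)‖ ≤ |det A/det Re A|^{1/2} · ∫dμ_{(Re A)⁻¹}(B) g(B)` — the printed passage from the complex measure
`dμ_{C^{(k)}(Z₀,σ(Z))}` to `|det(…)/det(Re …)|^{1/2} ∫dμ_{(Re C^{(k)}(Z₀,σ(Z))⁻¹)⁻¹}(B) |…|` (`|∫| ≤ ∫|·|`; nothing is
asked of `Ψ`). [cite: Balaban1988RG2Cluster, (2.15) p.15] -/
theorem norm_cgaussMean_le_215 {A : Matrix Λ Λ ℂ} (hAs : A.IsSymm) (hA : (A.map Complex.re).PosDef)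
    (Ψ : (Λ → ℝ) → ℂ) (g : (Λ → ℝ) → ℝ) (hΨ : ∀ B, ‖Ψ B‖ ≤ g B)
    (hg : Integrable (fun B => gaussWeight (A.map Complex.re) B * g B)) :
    ‖cgaussMean A Ψ‖ ≤ Real.sqrt (‖A.det‖ / (A.map Complex.re).det) * gaussMean (A.map Complex.re) g := by
  have hN : 0 < ‖cgaussNorm A‖ := norm_pos_iff.2 (cgaussNorm_ne_zero hAs hA).1
  have hG : 0 < gaussNorm (A.map Complex.re) := gaussNorm_pos hA
  rw [cgaussMean, norm_mul, norm_inv, cgaussInt, ← gaussNorm_div_norm_cgaussNorm hAs hA]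
  have h1 : ‖∫ v, cgaussWeight A v * Ψ v‖ ≤ ∫ v, gaussWeight (A.map Complex.re) v * g v := by
    refine (norm_integral_le_integral_norm _).trans
      (integral_mono_of_nonneg (Filter.Eventually.of_forall fun v => norm_nonneg _) hg
        (Filter.Eventually.of_forall fun v => ?_))
    show ‖cgaussWeight A v * Ψ v‖ ≤ gaussWeight (A.map Complex.re) v * g v
    rw [norm_mul, norm_cgaussWeight_eq_gaussWeight]
    exact mul_le_mul_of_nonneg_left (hΨ v) (Real.exp_pos _).le
  have h2 : ∫ v, gaussWeight (A.map Complex.re) v * g v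
      = gaussNorm (A.map Complex.re) * gaussMean (A.map Complex.re) g := by
    rw [gaussMean, gaussInt, smul_eq_mul, ← mul_assoc, mul_inv_cancel₀ hG.ne', one_mul]
    simp_rw [smul_eq_mul]
  calc ‖cgaussNorm A‖⁻¹ * ‖∫ v, cgaussWeight A v * Ψ v‖
      ≤ ‖cgaussNorm A‖⁻¹ * (gaussNorm (A.map Complex.re) * gaussMean (A.map Complex.re) g) :=
        mul_le_mul_of_nonneg_left (h1.trans_eq h2) (inv_nonneg.2 hN.le)
    _ = gaussNorm (A.map Complex.re) / ‖cgaussNorm A‖ * gaussMean (A.map Complex.re) g := by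
        rw [div_eq_mul_inv]
        ring

/-! ## §3. Lines 2–4 of (2.15) for the objects of record of (2.14) -/

omit [Fintype Λ] [DecidableEq Λ] in
/-- `|exp(−⟨B, ΓX⟩)| = exp(−⟨B, Re ΓX⟩)` for a real field `B` and a complex source `ΓX` — the printed
`exp(−⟨B, Re Γ_k(Z₀,σ(Z))X⟩)`. [cite: Balaban1988RG2Cluster, (2.15) p.15] -/
theorem norm_cexp_neg_dotProduct (B : Λ → ℝ) (J : Λ → ℂ) [Fintype Λ] :
    ‖Complex.exp (-((fun i => (B i : ℂ)) ⬝ᵥ J))‖ = Real.exp (-(B ⬝ᵥ fun i => (J i).re)) := by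
  rw [Complex.norm_exp]
  congr 1
  simp only [dotProduct, Complex.neg_re, Complex.re_sum, Complex.re_ofReal_mul]

variable {C₀ : Type}

/-- **(2.15), lines 2–3 for the objects of record of (2.14)**: for the function `B13Term214.integrand214 A Γ F X =
exp(−½⟨ΓX, A⁻¹ΓX⟩)·∫dμ_{A⁻¹}(B) e^{−⟨B,ΓX⟩}F(B)` with complex symmetric precision `A = C^{(k)}(Z₀,σ(Z))⁻¹`,
`Re A ≻ 0`, complex `Γ = Γ_k(Z₀,σ(Z))` and last line `‖F‖ ≤ g`:
`‖integrand214 A Γ F X‖ ≤ exp(−½ Re⟨ΓX, A⁻¹ΓX⟩) · |det A/det Re A|^{1/2} · ∫dμ_{(Re A)⁻¹}(B) e^{−⟨B, Re ΓX⟩} g(B)`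
— verbatim the printed `exp(−½Re⟨Γ_kX, C^{(k)}Γ_kX⟩)·|det C^{(k)⁻¹}/det Re C^{(k)⁻¹}|^{1/2} ∫dμ_{(Re C^{(k)⁻¹})⁻¹}(B)
exp(−⟨B,Re Γ_kX⟩)[…]`, given integrability of the majorant against the weight of `Re A`.
[cite: Balaban1988RG2Cluster, (2.15) p.15] -/
theorem norm_integrand214_le_215 {A : Matrix Λ Λ ℂ} (hAs : A.IsSymm) (hA : (A.map Complex.re).PosDef)
    (Γ : (Λ ⊕ C₀ → ℝ) → (Λ → ℂ)) (F : (Λ → ℝ) → ℂ) (g : (Λ → ℝ) → ℝ) (hF : ∀ B, ‖F B‖ ≤ g B)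
    (X : Λ ⊕ C₀ → ℝ)
    (hg : Integrable (fun B : Λ → ℝ =>
      gaussWeight (A.map Complex.re) B * (Real.exp (-(B ⬝ᵥ fun i => (Γ X i).re)) * g B))) :
    ‖integrand214 A Γ F X‖
      ≤ Real.exp (-(1 / 2) * ((Γ X) ⬝ᵥ (A⁻¹ *ᵥ Γ X)).re)
        * (Real.sqrt (‖A.det‖ / (A.map Complex.re).det)
          * gaussMean (A.map Complex.re) (fun B => Real.exp (-(B ⬝ᵥ fun i => (Γ X i).re)) * g B)) := by
  classical
  rw [integrand214, norm_mul, Complex.norm_exp]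
  refine mul_le_mul (le_of_eq ?_) (norm_cgaussMean_le_215 hAs hA _ _ (fun B => ?_) hg) (norm_nonneg _)
    (Real.exp_pos _).le
  · congr 1
    have : (-(1 / 2 : ℂ)) = ((-(1 / 2 : ℝ) : ℝ) : ℂ) := by push_cast; ring
    rw [this, Complex.re_ofReal_mul]
  · rw [norm_mul, norm_cexp_neg_dotProduct]
    exact mul_le_mul_of_nonneg_left (hF B) (Real.exp_pos _).le

/-- **(2.15), lines 2–4 for the objects of record: the `X`-integral** `∫dμ₀(X)|_Z (lines 2–4 of (2.14))` =
`B13Term214.cgaussMean 1 (integrand214 A Γ F)` (the value of `B13Term214.core214` at one parameter point) has modulus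
`≤ ∫dμ₀(X)|_Z exp(−½ Re⟨ΓX, A⁻¹ΓX⟩)·|det A/det Re A|^{1/2}·∫dμ_{(Re A)⁻¹}(B) e^{−⟨B,Re ΓX⟩}g(B)` — the right side of
(2.15) without the Cauchy prefactors of line 1 (those are `B13CauchyDecay.norm_term214_le_215`, which consumes the sup
of this modulus over the parameter polydiscs) — given the integrability of the two majorants (`hg`, `hX`).
[cite: Balaban1988RG2Cluster, (2.15) p.15] -/
theorem norm_core214_le_215 [Fintype C₀] [DecidableEq C₀] {A : Matrix Λ Λ ℂ} (hAs : A.IsSymm)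
    (hA : (A.map Complex.re).PosDef) (Γ : (Λ ⊕ C₀ → ℝ) → (Λ → ℂ)) (F : (Λ → ℝ) → ℂ)
    (g : (Λ → ℝ) → ℝ) (hF : ∀ B, ‖F B‖ ≤ g B)
    (hg : ∀ X : Λ ⊕ C₀ → ℝ, Integrable (fun B : Λ → ℝ =>
      gaussWeight (A.map Complex.re) B * (Real.exp (-(B ⬝ᵥ fun i => (Γ X i).re)) * g B)))
    (hX : Integrable (fun X : Λ ⊕ C₀ → ℝ => gaussWeight (1 : Matrix (Λ ⊕ C₀) (Λ ⊕ C₀) ℝ) X *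
      (Real.exp (-(1 / 2) * ((Γ X) ⬝ᵥ (A⁻¹ *ᵥ Γ X)).re)
        * (Real.sqrt (‖A.det‖ / (A.map Complex.re).det)
          * gaussMean (A.map Complex.re) (fun B => Real.exp (-(B ⬝ᵥ fun i => (Γ X i).re)) * g B))))) :
    ‖cgaussMean (1 : Matrix (Λ ⊕ C₀) (Λ ⊕ C₀) ℂ) (fun X => integrand214 A Γ F X)‖
      ≤ gaussMean (1 : Matrix (Λ ⊕ C₀) (Λ ⊕ C₀) ℝ) (fun X =>
          Real.exp (-(1 / 2) * ((Γ X) ⬝ᵥ (A⁻¹ *ᵥ Γ X)).re)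
            * (Real.sqrt (‖A.det‖ / (A.map Complex.re).det)
              * gaussMean (A.map Complex.re) (fun B => Real.exp (-(B ⬝ᵥ fun i => (Γ X i).re)) * g B))) := by
  classical
  have h1 : (1 : Matrix (Λ ⊕ C₀) (Λ ⊕ C₀) ℂ) = (1 : Matrix (Λ ⊕ C₀) (Λ ⊕ C₀) ℝ).map (algebraMap ℝ ℂ) :=
    (Matrix.map_one _ (map_zero _) (map_one _)).symm
  rw [h1, B13Term214.cgaussMean_real]
  exact norm_gaussMean_le _ _ _ (fun X => norm_integrand214_le_215 hAs hA Γ F g hF X (hg X)) hX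


omit [Fintype Λ] [DecidableEq Λ] in
/-- **The printed last line of (2.15)**: `|(−1)^{|P|} χ_{k,Y₀}(B) χᶜ_{k,P}(B) exp[Σ_{Y∈𝐃} τ(Y)𝐕_k(Y,B)]| ≤ χ_{k,Y₀}(B)
χᶜ_{k,P}(B) exp[Σ_{Y∈𝐃} |τ(Y)||𝐕_k(Y,B)|]` for the last line `B13Term214.F214` of (2.14) (characteristic functions
`≥ 0`). [cite: Balaban1988RG2Cluster, (2.15) p.15] -/
theorem norm_F214_le_printed {D : Type*} (cardP : ℕ) (χY₀ χcP : (Λ → ℝ) → ℝ) (Dfam : Finset D)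
    (V : D → (Λ → ℝ) → ℂ) (τ : D → ℂ) (B : Λ → ℝ) (hχ0 : 0 ≤ χY₀ B) (hχc0 : 0 ≤ χcP B) :
    ‖F214 cardP χY₀ χcP Dfam V τ B‖ ≤ χY₀ B * χcP B * Real.exp (∑ Y ∈ Dfam, ‖τ Y‖ * ‖V Y B‖) := by
  rw [F214, norm_mul, norm_mul, norm_mul, norm_pow, norm_neg, norm_one, one_pow, one_mul, Complex.norm_real,
    Complex.norm_real, Real.norm_eq_abs, Real.norm_eq_abs, abs_of_nonneg hχ0, abs_of_nonneg hχc0, Complex.norm_exp]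
  refine mul_le_mul_of_nonneg_left (Real.exp_le_exp.2 ?_) (mul_nonneg hχ0 hχc0)
  rw [Complex.re_sum]
  exact Finset.sum_le_sum fun Y _ => (Complex.re_le_norm _).trans (norm_mul_le _ _)

/-- **(2.15), lines 2–4, with the printed last line**: for `F = (−1)^{|P|}χ_{k,Y₀}χᶜ_{k,P}exp[Στ(Y)𝐕_k(Y,·)]`
(`B13Term214.F214`, characteristic functions `≥ 0`) the `X`-integral of lines 2–4 of (2.14) is bounded by
`∫dμ₀(X)|_Z e^{−½Re⟨ΓX,A⁻¹ΓX⟩} |det A/det Re A|^{1/2} ∫dμ_{(Re A)⁻¹}(B) e^{−⟨B,Re ΓX⟩} χ_{k,Y₀}χᶜ_{k,P} e^{Σ|τ(Y)||𝐕_k(Y,B)|}`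
— the right-hand side of (2.15) after its first line — given integrability of the two majorants.
[cite: Balaban1988RG2Cluster, (2.15) p.15] -/
theorem norm_core214_F214_le_215 [Fintype C₀] [DecidableEq C₀] {D : Type*} {A : Matrix Λ Λ ℂ} (hAs : A.IsSymm)
    (hA : (A.map Complex.re).PosDef) (Γ : (Λ ⊕ C₀ → ℝ) → (Λ → ℂ)) (cardP : ℕ) (χY₀ χcP : (Λ → ℝ) → ℝ)
    (hχ0 : ∀ B, 0 ≤ χY₀ B) (hχc0 : ∀ B, 0 ≤ χcP B) (Dfam : Finset D) (V : D → (Λ → ℝ) → ℂ) (τ : D → ℂ)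
    (hg : ∀ X : Λ ⊕ C₀ → ℝ, Integrable (fun B : Λ → ℝ =>
      gaussWeight (A.map Complex.re) B * (Real.exp (-(B ⬝ᵥ fun i => (Γ X i).re))
        * (χY₀ B * χcP B * Real.exp (∑ Y ∈ Dfam, ‖τ Y‖ * ‖V Y B‖)))))
    (hX : Integrable (fun X : Λ ⊕ C₀ → ℝ => gaussWeight (1 : Matrix (Λ ⊕ C₀) (Λ ⊕ C₀) ℝ) X *
      (Real.exp (-(1 / 2) * ((Γ X) ⬝ᵥ (A⁻¹ *ᵥ Γ X)).re)
        * (Real.sqrt (‖A.det‖ / (A.map Complex.re).det)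
          * gaussMean (A.map Complex.re) (fun B => Real.exp (-(B ⬝ᵥ fun i => (Γ X i).re))
            * (χY₀ B * χcP B * Real.exp (∑ Y ∈ Dfam, ‖τ Y‖ * ‖V Y B‖))))))) :
    ‖cgaussMean (1 : Matrix (Λ ⊕ C₀) (Λ ⊕ C₀) ℂ) (fun X => integrand214 A Γ (F214 cardP χY₀ χcP Dfam V τ) X)‖
      ≤ gaussMean (1 : Matrix (Λ ⊕ C₀) (Λ ⊕ C₀) ℝ) (fun X =>
          Real.exp (-(1 / 2) * ((Γ X) ⬝ᵥ (A⁻¹ *ᵥ Γ X)).re)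
            * (Real.sqrt (‖A.det‖ / (A.map Complex.re).det)
              * gaussMean (A.map Complex.re) (fun B => Real.exp (-(B ⬝ᵥ fun i => (Γ X i).re))
                * (χY₀ B * χcP B * Real.exp (∑ Y ∈ Dfam, ‖τ Y‖ * ‖V Y B‖))))) :=
  norm_core214_le_215 hAs hA Γ _ _ (fun B => norm_F214_le_printed cardP χY₀ χcP Dfam V τ B (hχ0 B) (hχc0 B)) hg hX

end Literature.MathematicalPhysics.QuantumFieldTheory.Balaban1983to89.B13FirstEstimate215

end
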